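/-
Copyright (c) 2026. All rights reserved.
Released under Apache 2.0 license as described in the file LICENSE.
-/
import Summits.AtomisticToContinuum.Crystallization.Theorems.ChartedZeroExcessLayeredLatticeLiouvilleVI

/-!
# ChartedZeroExcessLayeredLatticeLiouville — part VJ «ChainCoercive I»: cylinders, the kernel row bound, the lower bound and the deep row
  (decomp-a2c-lens-2, g57; helper of stmt-AtomisticToContinuum-26636, leaf (LD′) `ModalLipschitzZ`; brick (b1) `chainCoercive_of_coerciveZ`, critic rows 915/919)

The coercivity transfer from the laminate's `CoerciveZ` certificate to its 1D chain operator (memo NODE-g57j §2) tests `CoerciveZ` (through UT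
`truncForm_coercive`) on the CUT PROFILES `χ = cutProfile (planarBall R_c) cf` and compares the two sides of `(2κ₀ − ε)·nnFormZ χ ≤ Q_ϱ(χ)`:
* VJ.1 `planarBall R` (in-plane index ball, `#= (2R+1)²`), `layerCollar S r`, and WHERE THE NEAR SET OF THE CYLINDER LIVES: `nearSet (planarBall R_c ×ˢ S) ⊆
  planarBall (R_c + r) ×ˢ layerCollar S r`, `r = ⌊ϱ/c⌋₊` (`fst_mem_planarBall_of_mem_nearSet`, `snd_mem_layerCollar_of_mem_nearSet`);
* VJ.2 the uniform KERNEL ROW BOUND `|Σ_q nearFam χ (p, q)| ≤ (2r+1)³ · F(c) · (2m)²` for `‖χ‖ ≤ m` (`abs_row_nearFam_le_card`; UY `kernelConst`);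
* VJ.3 the LOWER BOUND `(2R+1)² · Σ_{k<2R} ‖cf (k−R+1) − cf (k−R)‖² ≤ idxEnergy χ (idxBall 0 R)` (VE's chart `cubePt` along `idxAxis₃`) and the re-indexing
  `Σ_{α ∈ T} g α ≤ Σ_{k<2R} g (k − R)` for non-negative `g` vanishing off `[−R, R)`;
* VJ.4 ★ the DEEP ROW of `Q_ϱ(χ)` equals the CHAIN ROW `Σ_{β ∈ W} chainT cf α β` for every layer set `W` closed under the band around `supp cf`
  (`deep_row_eq`: VI `row_nearFam_cutProfile_eq` + support bookkeeping + `chainK_translate`).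
Part VK sums the rows and passes to the limit `R → ∞`.
-/

namespace Summit.AtomisticToContinuum.Crystallization.Theorems.ChartedZeroExcessLayeredLatticeLiouville

open Summit.AtomisticToContinuum.Crystallization.Theorems.ChartedPlanarOrderRigidityDoor (E3)
open Finset
open scoped InnerProductSpace RealInnerProductSpace BigOperators

noncomputable section ChainCoercive

variable {c : ℝ} {a b : E3} {w : ℤ → E3}

/-! ### VJ.1  Planar balls, layer collars, and the near set of a cylinder -/

/-- the in-plane index ball of radius `R`: cells with both coordinates in `[−R, R]`. [this file, g57] -/
def planarBall (R : ℕ) : Finset (Cell 2) :=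
  Fintype.piFinset fun _ : Fin 2 => Finset.Icc (-(R : ℤ)) R

/-- Membership in `planarBall`. [formal bookkeeping] -/
theorem mem_planarBall {R : ℕ} {γ : Cell 2} : γ ∈ planarBall R ↔ ∀ j, (γ j).natAbs ≤ R := by
  unfold planarBall
  rw [Fintype.mem_piFinset]
  refine forall_congr' fun j => ?_
  rw [Finset.mem_Icc]
  omega

/-- `#planarBall R = (2R+1)²`. [formal bookkeeping] -/
theorem card_planarBall (R : ℕ) : (planarBall R).card = (2 * R + 1) ^ 2 := by
  unfold planarBall
  rw [Fintype.card_piFinset, prod_const, card_univ, Fintype.card_fin, Int.card_Icc]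
  have h : ((R : ℤ) + 1 - -(R : ℤ)).toNat = 2 * R + 1 := by omega
  rw [h]

/-- `planarBall` is monotone. [formal bookkeeping] -/
theorem planarBall_mono {R R' : ℕ} (h : R ≤ R') : planarBall R ⊆ planarBall R' := fun _ hγ =>
  mem_planarBall.mpr fun j => (mem_planarBall.mp hγ j).trans h

/-- translates of a planar ball by short vectors stay in the enlarged ball. [formal bookkeeping] -/
theorem add_mem_planarBall {R r : ℕ} {γ δ : Cell 2} (hγ : γ ∈ planarBall R) (hδ : ∀ j, (δ j).natAbs ≤ r) :
    γ + δ ∈ planarBall (R + r) := by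
  refine mem_planarBall.mpr fun j => ?_
  rw [Pi.add_apply]
  exact (Int.natAbs_add_le _ _).trans (add_le_add (mem_planarBall.mp hγ j) (hδ j))

/-- the in-plane part of an index vector of sup-norm `≤ R` lies in `planarBall R`. [formal bookkeeping] -/
theorem fst_mem_planarBall_of_idxNorm {v : Cell 2 × ℤ} {R : ℕ} (h : idxNorm v ≤ R) : v.1 ∈ planarBall R :=
  mem_planarBall.mpr fun j => (natAbs_fst_le_idxNorm v j).trans h

/-- the LAYER COLLAR of a layer set: all layers within `r` of it. [this file, g57] -/
def layerCollar (S : Finset ℤ) (r : ℕ) : Finset ℤ :=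
  S.biUnion fun α => Finset.Icc (α - r) (α + r)

/-- Membership in the layer collar from a nearby member. [formal bookkeeping] -/
theorem mem_layerCollar_of {S : Finset ℤ} {r : ℕ} {α β : ℤ} (hα : α ∈ S) (h : (β - α).natAbs ≤ r) : β ∈ layerCollar S r := by
  unfold layerCollar
  refine mem_biUnion.mpr ⟨α, hα, mem_Icc.mpr ?_⟩
  omega

/-- near sites are index-close: `idxNorm (Y − X) ≤ ⌊ϱ/c⌋₊` (co-Lipschitz). [this file, g57] -/
theorem idxNorm_le_of_near (hc : 0 < c) (hL : IsLayeredCrystal c a b w) {ϱ : ℝ} {X Y : Cell 2 × ℤ}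
    (h : ‖lsite a b w Y.1 Y.2 - lsite a b w X.1 X.2‖ ≤ ϱ) : idxNorm (Y - X) ≤ ⌊ϱ / c⌋₊ := by
  refine Nat.le_floor ?_
  rw [← dist_eq_idxNorm, le_div_iff₀ hc, mul_comm, dist_comm]
  exact (hL Y X).trans h

/-- near sites of the cylinder have in-plane part in the enlarged planar ball. [this file, g57] -/
theorem fst_mem_planarBall_of_mem_nearSet (hc : 0 < c) (hL : IsLayeredCrystal c a b w) {ϱ : ℝ} {R : ℕ} {S : Finset ℤ}
    {Y : Cell 2 × ℤ} (hY : Y ∈ nearSet hc hL ϱ (planarBall R ×ˢ S)) : Y.1 ∈ planarBall (R + ⌊ϱ / c⌋₊) := by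
  unfold nearSet at hY
  obtain ⟨X, hX, hYX⟩ := mem_biUnion.mp hY
  rw [Set.Finite.mem_toFinset, Set.mem_setOf_eq] at hYX
  have h1 : Y.1 = X.1 + (Y - X).1 := by simp
  rw [h1]
  exact add_mem_planarBall (mem_product.mp hX).1 fun j => (natAbs_fst_le_idxNorm (Y - X) j).trans (idxNorm_le_of_near hc hL hYX)

/-- near sites of the cylinder have layer in the collar. [this file, g57] -/
theorem snd_mem_layerCollar_of_mem_nearSet (hc : 0 < c) (hL : IsLayeredCrystal c a b w) {ϱ : ℝ} {R : ℕ} {S : Finset ℤ}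
    {Y : Cell 2 × ℤ} (hY : Y ∈ nearSet hc hL ϱ (planarBall R ×ˢ S)) : Y.2 ∈ layerCollar S ⌊ϱ / c⌋₊ := by
  unfold nearSet at hY
  obtain ⟨X, hX, hYX⟩ := mem_biUnion.mp hY
  rw [Set.Finite.mem_toFinset, Set.mem_setOf_eq] at hYX
  exact mem_layerCollar_of (mem_product.mp hX).2 ((natAbs_snd_le_idxNorm (Y - X)).trans (idxNorm_le_of_near hc hL hYX))

/-! ### VJ.2  The uniform kernel row bound -/

/-- every truncated bond operator is bounded by `F(c)` (UY `kernelConst`; the diagonal included). [this file, g57] -/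
theorem norm_nearK_le_kernelConst (hc : 0 < c) (hL : IsLayeredCrystal c a b w) (ϱ : ℝ) (X Y : Cell 2 × ℤ) (u : E3) :
    ‖nearK ϱ a b w X Y u‖ ≤ kernelConst c * ‖u‖ := by
  refine (norm_nearK_le ϱ a b w X Y u).trans (mul_le_mul_of_nonneg_right ?_ (norm_nonneg u))
  refine (norm_layeredKernel_le hc hL X Y).trans ?_
  have h1 : (((idxNorm (Y - X) : ℝ))⁻¹) ^ 8 ≤ 1 := by
    refine pow_le_one₀ (inv_nonneg.mpr (Nat.cast_nonneg _)) ?_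
    rcases Nat.eq_zero_or_pos (idxNorm (Y - X)) with h0 | hpos
    · rw [h0, Nat.cast_zero, inv_zero]; exact zero_le_one
    · exact inv_le_one_of_one_le₀ (by exact_mod_cast hpos)
  calc kernelConst c * (((idxNorm (Y - X) : ℝ))⁻¹) ^ 8 ≤ kernelConst c * 1 := mul_le_mul_of_nonneg_left h1 (kernelConst_nonneg hc)
    _ = kernelConst c := mul_one _

/-- ★ UNIFORM ROW BOUND: for a field bounded by `m` every row of the truncated quadratic form is at most `(2⌊ϱ/c⌋₊+1)³ · F(c) · (2m)²` in absolute value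
(only the `(2r+1)³` index-near sites contribute, each by `F(c)(2m)²`). [this file, g57] -/
theorem abs_row_nearFam_le_card (hc : 0 < c) (hL : IsLayeredCrystal c a b w) {ϱ : ℝ} (hϱ : 0 ≤ ϱ) (χ : Cell 2 → ℤ → E3) {m : ℝ}
    (hm : ∀ X : Cell 2 × ℤ, ‖χ X.1 X.2‖ ≤ m) (p : Cell 2 × ℤ) (N : Finset (Cell 2 × ℤ)) :
    |∑ q ∈ N, nearFam ϱ a b w χ (p, q)| ≤ (((2 * ⌊ϱ / c⌋₊ + 1) ^ 3 : ℕ) : ℝ) * (kernelConst c * (2 * m) ^ 2) := by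
  refine (abs_row_nearFam_le χ p N).trans ?_
  have hm0 : 0 ≤ m := (norm_nonneg _).trans (hm p)
  have hK := kernelConst_nonneg hc
  have hfar : ∀ q ∈ N, ‖nearK ϱ a b w p q (χ q.1 q.2 - χ p.1 p.2)‖ * ‖χ q.1 q.2 - χ p.1 p.2‖ ≠ 0 → q ∈ idxBallF p (ϱ / c) := by
    intro q _ hq
    rw [mem_idxBallF]
    by_contra hqfar
    refine hq ?_
    have hlt : ϱ < ‖lsite a b w q.1 q.2 - lsite a b w p.1 p.2‖ := by
      by_contra hle
      exact hqfar (by rw [le_div_iff₀ hc, mul_comm]; exact (hL q p).trans (not_lt.mp hle))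
    rw [nearK_eq_zero_of_lt (X := p) (Y := q) hlt, norm_zero, zero_mul]
  rw [← sum_filter_of_ne hfar]
  have hle : ∀ q ∈ N.filter (fun q => q ∈ idxBallF p (ϱ / c)),
      ‖nearK ϱ a b w p q (χ q.1 q.2 - χ p.1 p.2)‖ * ‖χ q.1 q.2 - χ p.1 p.2‖ ≤ kernelConst c * (2 * m) ^ 2 := by
    intro q _
    have hΔ : ‖χ q.1 q.2 - χ p.1 p.2‖ ≤ 2 * m := (norm_sub_le _ _).trans (by linarith [hm q, hm p])
    have hΔ0 := norm_nonneg (χ q.1 q.2 - χ p.1 p.2)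
    calc ‖nearK ϱ a b w p q (χ q.1 q.2 - χ p.1 p.2)‖ * ‖χ q.1 q.2 - χ p.1 p.2‖
        ≤ kernelConst c * ‖χ q.1 q.2 - χ p.1 p.2‖ * ‖χ q.1 q.2 - χ p.1 p.2‖ :=
          mul_le_mul_of_nonneg_right (norm_nearK_le_kernelConst hc hL ϱ p q _) hΔ0
      _ ≤ kernelConst c * (2 * m) * (2 * m) := mul_le_mul (mul_le_mul_of_nonneg_left hΔ hK) hΔ hΔ0 (by positivity)
      _ = kernelConst c * (2 * m) ^ 2 := by ring
  refine (sum_le_card_nsmul _ _ _ hle).trans ?_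
  rw [nsmul_eq_mul]
  refine mul_le_mul_of_nonneg_right ?_ (by positivity)
  have hsub : N.filter (fun q => q ∈ idxBallF p (ϱ / c)) ⊆ idxBallF p (ϱ / c) := fun q hq => (mem_filter.mp hq).2
  have hcard := Finset.card_le_card hsub
  rw [card_idxBallF_eq p (div_nonneg hϱ hc.le)] at hcard
  exact_mod_cast hcard

/-! ### VJ.3  The lower bound through the cube chart and the layer re-indexing -/

/-- ★ LOWER BOUND: the cross-layer increments of the profile, counted over the `(2R+1)²` columns of the index cube, are below the localised index energy of the
cut profile: `(2R+1)² · Σ_{k<2R} ‖cf (k−R+1) − cf (k−R)‖² ≤ idxEnergy χ (idxBall 0 R)`. [this file, g57] -/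
theorem sq_mul_sum_le_idxEnergy_cutProfile (R : ℕ) (cf : ℤ → E3) :
    (((2 * R + 1 : ℕ)) : ℝ) ^ 2 * ∑ k ∈ Finset.range (2 * R), ‖cf ((k : ℤ) - R + 1) - cf ((k : ℤ) - R)‖ ^ 2 ≤
      idxEnergy (cutProfile (planarBall R) cf) (idxBall 0 R) := by
  have hn : (0 : ℝ) ≤ (R : ℝ) := Nat.cast_nonneg R
  have hfl : ⌊(R : ℝ)⌋₊ = R := Nat.floor_natCast R
  have hstep : ∀ i ∈ Finset.range (2 * R + 1), ∀ j ∈ Finset.range (2 * R + 1), ∀ k ∈ Finset.range (2 * R),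
      cubePt 0 ⌊(R : ℝ)⌋₊ i j k + idxAxis₃ ∈ idxBallF 0 (R : ℝ) := by
    intro i hi j hj k hk
    rw [Finset.mem_range] at hi hj hk
    rw [← cubePt_succ₃]
    exact cubePt_mem 0 hn (by omega) (by omega) (by omega)
  have h := boxSum_latDiff_le_idxEnergy (0 : Cell 2 × ℤ) hn (cutProfile (planarBall R) cf) (e := idxAxis₃) dist_add_idxAxis₃_le
    (a := Finset.range (2 * R + 1)) (b := Finset.range (2 * R + 1)) (c := Finset.range (2 * R))
    (by rw [hfl]) (by rw [hfl]) (by rw [hfl]; exact Finset.range_mono (by omega)) hstep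
  rw [hfl] at h
  refine le_trans (le_of_eq ?_) h
  have hval : ∀ j ∈ Finset.range (2 * R + 1), ∀ i ∈ Finset.range (2 * R + 1), ∀ k ∈ Finset.range (2 * R),
      ‖latDiff idxAxis₃ (cutProfile (planarBall R) cf) (cubePt 0 R i j k).1 (cubePt 0 R i j k).2‖ ^ 2 =
        ‖cf ((k : ℤ) - R + 1) - cf ((k : ℤ) - R)‖ ^ 2 := by
    intro j hj i hi k hk
    rw [Finset.mem_range] at hi hj hk
    have hmem : cubePt 0 R i j k ∈ idxBallF 0 (R : ℝ) := by
      have := cubePt_mem (0 : Cell 2 × ℤ) hn (i := i) (j := j) (k := k) (by omega) (by omega) (by omega)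
      rwa [hfl] at this
    have h1 : (cubePt 0 R i j k).1 ∈ planarBall R := by
      rw [mem_idxBallF_iff_idxNorm, sub_zero, Nat.cast_le] at hmem
      exact fst_mem_planarBall_of_idxNorm hmem
    have h2 : (cubePt 0 R i j k).2 = (k : ℤ) - R := by
      have := cubePt_sub_snd (0 : Cell 2 × ℤ) R i j k
      rwa [sub_zero] at this
    have h3 : (cubePt 0 R i j k + idxAxis₃).1 = (cubePt 0 R i j k).1 := by simp [idxAxis₃]
    have h4 : (cubePt 0 R i j k + idxAxis₃).2 = (cubePt 0 R i j k).2 + 1 := by simp [idxAxis₃]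
    rw [latDiff_apply, h3, h4, cutProfile_of_mem cf h1, cutProfile_of_mem cf h1, h2]
  rw [Finset.sum_congr rfl fun j hj => Finset.sum_congr rfl fun i hi => Finset.sum_congr rfl fun k hk => hval j hj i hi k hk]
  simp only [Finset.sum_const, Finset.card_range, nsmul_eq_mul]
  push_cast
  ring

/-- RE-INDEXING: a sum of a non-negative layer function vanishing off `[−R, R)` over ANY layer set is below its sum over the chart's layer range. [formal bookkeeping] -/
theorem sum_le_sum_range_shift {g : ℤ → ℝ} (hg : ∀ α, 0 ≤ g α) {R : ℕ} (hvan : ∀ α, g α ≠ 0 → -(R : ℤ) ≤ α ∧ α < R) (T : Finset ℤ) :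
    ∑ α ∈ T, g α ≤ ∑ k ∈ Finset.range (2 * R), g ((k : ℤ) - R) := by
  have himg : ∑ k ∈ Finset.range (2 * R), g ((k : ℤ) - R) = ∑ α ∈ (Finset.range (2 * R)).image (fun k : ℕ => (k : ℤ) - R), g α := by
    rw [Finset.sum_image]
    intro x _ y _ h
    have : (x : ℤ) = y := by linarith
    exact_mod_cast this
  rw [himg, ← Finset.sum_filter_ne_zero T]
  refine Finset.sum_le_sum_of_subset_of_nonneg (fun α hα => ?_) fun α _ _ => hg α
  obtain ⟨_, hne⟩ := Finset.mem_filter.mp hα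
  obtain ⟨h1, h2⟩ := hvan α hne
  refine Finset.mem_image.mpr ⟨(α + R).toNat, Finset.mem_range.mpr (by omega), by omega⟩

/-! ### VJ.4  The chain form entries and the deep row -/

/-- the entries of the CHAIN QUADRATIC FORM of a profile: `T(α, β) = ⟪cf β − cf α, chainK (0, α) β (cf β − cf α)⟫`. [this file, g57] -/
def chainT (ϱ : ℝ) (a b : E3) (w : ℤ → E3) (cf : ℤ → E3) (α β : ℤ) : ℝ :=
  ⟪cf β - cf α, chainK ϱ a b w ((0 : Cell 2), α) β (cf β - cf α)⟫_ℝ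

/-- two finite sums of one function agree when both index sets contain its support. [formal bookkeeping] -/
theorem sum_eq_sum_of_support {f : ℤ → ℝ} {V W : Finset ℤ} (hV : ∀ β, f β ≠ 0 → β ∈ V) (hW : ∀ β, f β ≠ 0 → β ∈ W) :
    ∑ β ∈ V, f β = ∑ β ∈ W, f β := by
  rw [Finset.sum_subset (Finset.subset_union_left (s₁ := V) (s₂ := W)) fun β _ hβ => ?_,
    Finset.sum_subset (Finset.subset_union_right (s₁ := V) (s₂ := W)) fun β _ hβ => ?_]
  · by_contra h; exact hβ (hW β h)
  · by_contra h; exact hβ (hV β h)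

/-- `chainK X β 0 = 0`. [formal bookkeeping] -/
theorem chainK_zero (hc : 0 < c) (hL : IsLayeredCrystal c a b w) (ϱ : ℝ) (X : Cell 2 × ℤ) (β : ℤ) : chainK ϱ a b w X β 0 = 0 := by
  have h := chainK_smul hc hL ϱ X β 0 0
  rwa [zero_smul, zero_smul] at h

/-- a non-zero chain entry forces the band `c·|β − α| ≤ ϱ` and a non-zero profile value at one end. [formal bookkeeping] -/
theorem band_of_chainK_ne_zero (hc : 0 < c) (hL : IsLayeredCrystal c a b w) {ϱ : ℝ} {cf : ℤ → E3} {X : Cell 2 × ℤ} {β : ℤ}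
    (h : chainK ϱ a b w X β (cf β - cf X.2) ≠ 0) : c * |(((β - X.2 : ℤ)) : ℝ)| ≤ ϱ ∧ (cf X.2 ≠ 0 ∨ cf β ≠ 0) := by
  refine ⟨not_lt.mp fun hfar => h (chainK_eq_zero_of_far hc hL hfar _), ?_⟩
  by_contra hboth
  simp only [not_or, not_not] at hboth
  rw [hboth.1, hboth.2, sub_zero, chainK_zero hc hL] at h
  exact h rfl

end ChainCoercive

end Summit.AtomisticToContinuum.Crystallization.Theorems.ChartedZeroExcessLayeredLatticeLiouville
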